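import Summits.FinalStateConjecture.FinalStateConjecture.Theorems.EIHFluxBalanceInertialRecessionRechartWhiteHoleKerrAlgebra
import Summits.FinalStateConjecture.FinalStateConjecture.Theorems.EIHFluxBalanceInertialRecessionRechartWhiteHoleMargin
import Literature.Geometry.Lorentzian.KerrSchildCoord

/-!
# Route EIHFluxBalance — `InertialRecession`, re-charting: uniform margin of the axis escape
# configuration under frame drift (white-hole exclusion for ROTATING holes)

Helper file for the crux `stmt-FinalStateConjecture-10166`
(`Summit.FinalStateConjecture.FinalStateConjecture.Theses.EIHFluxBalance.InertialRecession`),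
stub `stub_rechart` of line `sublinear-is-free-clean-window-charges`.

The painted own term of a hole at a lab point `x` is `g_{M,a}(P z)(P W, P W)` with `P = Λ(t)⁻¹`
the inverse painted frame at the lab time `t = x⁰` and `z = x − c(t)` the offset from the painted
centre (`boostedKerrBilin_eq_symm_clm`). Along the escape segment the EXACT configuration is
`(P, z, W) = (Λ₀⁻¹, Λ₀ ζ(s, τ), Λ₀ w₀)` with the rest escape configuration
`ζ(s, τ) = (−s − τ)e₀ + (ρ + s/2)e₃` and direction `w₀ = −e₀ + ½e₃` of `…KerrAlgebra` (radius
`ρ + s/2`, value `−3/4 + M r/(2(r² + a²))`), where `Λ₀` ranges over the frames of bounded Lorentz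
factor — a COMPACT set of operators. `exists_kerr_escape_margin`: uniformly over that compact set
and over `|s| ≤ S`, `|τ| ≤ T`, a `δ`-perturbation of the inverse frame (operator norm) and of the
offset changes the painted radius and the painted own value by less than `ε` (uniform continuity
near a compact set inside the open set `{r > 0}` where the Kerr–Schild form is smooth,
`exists_uniform_margin`, `Kerr.contDiffAt_bilin`).

[Kerr–Schild 1965, §2; folklore compactness bookkeeping]
-/

noncomputable section

set_option linter.dupNamespace false

open Set Function Metric Topology Literature.Geometry.Lorentzian

namespace Summit.FinalStateConjecture.FinalStateConjecture.Theorems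

/-- **The inverse pairs of operators of norm `≤ Γ` form a compact set** (closed and bounded in a
finite-dimensional space). [folklore] -/
theorem isCompact_inversePairs (Γ : ℝ) :
    IsCompact {q : (E4 →L[ℝ] E4) × (E4 →L[ℝ] E4) |
      q.1.comp q.2 = 1 ∧ q.2.comp q.1 = 1 ∧ ‖q.1‖ ≤ Γ ∧ ‖q.2‖ ≤ Γ} := by
  have h1 : IsClosed {q : (E4 →L[ℝ] E4) × (E4 →L[ℝ] E4) | q.1.comp q.2 = 1} :=
    isClosed_eq (continuous_fst.clm_comp continuous_snd) continuous_const
  have h2 : IsClosed {q : (E4 →L[ℝ] E4) × (E4 →L[ℝ] E4) | q.2.comp q.1 = 1} :=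
    isClosed_eq (continuous_snd.clm_comp continuous_fst) continuous_const
  have h3 : IsClosed {q : (E4 →L[ℝ] E4) × (E4 →L[ℝ] E4) | ‖q.1‖ ≤ Γ} :=
    isClosed_le continuous_fst.norm continuous_const
  have h4 : IsClosed {q : (E4 →L[ℝ] E4) × (E4 →L[ℝ] E4) | ‖q.2‖ ≤ Γ} :=
    isClosed_le continuous_snd.norm continuous_const
  have hcl : IsClosed {q : (E4 →L[ℝ] E4) × (E4 →L[ℝ] E4) |
      q.1.comp q.2 = 1 ∧ q.2.comp q.1 = 1 ∧ ‖q.1‖ ≤ Γ ∧ ‖q.2‖ ≤ Γ} := by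
    simp only [Set.setOf_and]
    exact h1.inter (h2.inter (h3.inter h4))
  have hbd : Bornology.IsBounded {q : (E4 →L[ℝ] E4) × (E4 →L[ℝ] E4) |
      q.1.comp q.2 = 1 ∧ q.2.comp q.1 = 1 ∧ ‖q.1‖ ≤ Γ ∧ ‖q.2‖ ≤ Γ} := by
    refine ((isBounded_closedBall (x := (0 : E4 →L[ℝ] E4)) (r := Γ)).prod
      (isBounded_closedBall (x := (0 : E4 →L[ℝ] E4)) (r := Γ))).subset ?_
    rintro q ⟨-, -, hq1, hq2⟩
    exact ⟨mem_closedBall_zero_iff.mpr hq1, mem_closedBall_zero_iff.mpr hq2⟩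
  exact Metric.isCompact_of_isClosed_isBounded hcl hbd

/-- The painted-radius function `(P, z, W) ↦ r_a(P z)` is continuous. [folklore] -/
theorem continuous_config_radius (a : ℝ) :
    Continuous fun p : (E4 →L[ℝ] E4) × E4 × E4 ↦ Kerr.radius a (p.1 p.2.1) :=
  (Kerr.continuous_radius a).comp (continuous_fst.clm_apply (continuous_fst.comp continuous_snd))

/-- The painted-value function `(P, z, W) ↦ g_{M,a}(P z)(P W, P W)` is continuous on
`{r_a(P z) > 0}`. [folklore] -/
theorem continuousOn_config_value (M a : ℝ) :
    ContinuousOn (fun p : (E4 →L[ℝ] E4) × E4 × E4 ↦ Kerr.bilin M a (p.1 p.2.1) (p.1 p.2.2) (p.1 p.2.2))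
      {p | 0 < Kerr.radius a (p.1 p.2.1)} := by
  intro p hp
  have hy : Continuous fun q : (E4 →L[ℝ] E4) × E4 × E4 ↦ q.1 q.2.1 :=
    continuous_fst.clm_apply (continuous_fst.comp continuous_snd)
  have hW : Continuous fun q : (E4 →L[ℝ] E4) × E4 × E4 ↦ q.1 q.2.2 :=
    continuous_fst.clm_apply (continuous_snd.comp continuous_snd)
  have hB : ContinuousAt (fun q : (E4 →L[ℝ] E4) × E4 × E4 ↦ Kerr.bilin M a (q.1 q.2.1)) p :=
    ContinuousAt.comp (f := fun q : (E4 →L[ℝ] E4) × E4 × E4 ↦ q.1 q.2.1) (g := Kerr.bilin M a)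
      (x := p) (Kerr.contDiffAt_bilin M a hp (n := 0)).continuousAt hy.continuousAt
  exact ((hB.clm_apply hW.continuousAt).clm_apply hW.continuousAt).continuousWithinAt

-- bookkeeping over a compact configuration set
set_option maxHeartbeats 800000 in
/-- **Uniform margin of the axis escape configuration under frame drift.** For `M, a`, a norm
bound `Γ`, a base radius `ρ` and windows `S, T` with `S/2 < ρ`, and `ε > 0`, there is `δ > 0`
such that: for every inverse pair `(P, Q)` of operators of norm `≤ Γ`, all `|s| ≤ S`, `|τ| ≤ T`,
every operator `P'` with `‖P' − P‖ ≤ δ` and every offset `z'` with `‖z' − Q ζ(s,τ)‖ ≤ δ`, the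
painted radius `r_a(P' z')` is within `ε` of `ρ + s/2` and the painted value
`g_{M,a}(P' z')(P' Q w₀, P' Q w₀)` is below `−3/4 + M(ρ + s/2)/(2((ρ + s/2)² + a²)) + ε`.
[folklore] -/
theorem exists_kerr_escape_margin (M a Γ ρ S T : ℝ) (hρS : S / 2 < ρ) {ε : ℝ} (hε : 0 < ε) :
    ∃ δ > 0, ∀ (P Q : E4 →L[ℝ] E4), P.comp Q = 1 → Q.comp P = 1 → ‖P‖ ≤ Γ → ‖Q‖ ≤ Γ →
      ∀ s ∈ Icc (-S) S, ∀ τ ∈ Icc (-T) T, ∀ (P' : E4 →L[ℝ] E4) (z' : E4), ‖P' - P‖ ≤ δ →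
        ‖z' - Q ((-s - τ) • E4.basisVector 0 + (ρ + s / 2) • E4.basisVector 3)‖ ≤ δ →
        |Kerr.radius a (P' z') - (ρ + s / 2)| < ε ∧
          Kerr.bilin M a (P' z') (P' (Q (-E4.basisVector 0 + (1 / 2 : ℝ) • E4.basisVector 3)))
              (P' (Q (-E4.basisVector 0 + (1 / 2 : ℝ) • E4.basisVector 3))) <
            -(3 / 4) + M * (ρ + s / 2) / (2 * ((ρ + s / 2) ^ 2 + a ^ 2)) + ε := by
  -- the compact parameter set and the configuration map
  set C : Set ((E4 →L[ℝ] E4) × (E4 →L[ℝ] E4)) := {q | q.1.comp q.2 = 1 ∧ q.2.comp q.1 = 1 ∧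
    ‖q.1‖ ≤ Γ ∧ ‖q.2‖ ≤ Γ} with hC
  set w₀ : E4 := -E4.basisVector 0 + (1 / 2 : ℝ) • E4.basisVector 3 with hw₀
  set ζ : ℝ × ℝ → E4 := fun st ↦ (-st.1 - st.2) • E4.basisVector 0 + (ρ + st.1 / 2) • E4.basisVector 3
    with hζ
  set Θ : ((E4 →L[ℝ] E4) × (E4 →L[ℝ] E4)) × (ℝ × ℝ) → (E4 →L[ℝ] E4) × E4 × E4 :=
    fun π ↦ (π.1.1, π.1.2 (ζ π.2), π.1.2 w₀) with hΘ
  have hζc : Continuous ζ := by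
    rw [hζ]
    exact ((continuous_fst.neg.sub continuous_snd).smul continuous_const).add
      ((continuous_const.add (continuous_fst.div_const _)).smul continuous_const)
  have hΘc : Continuous Θ := by
    rw [hΘ]
    refine (continuous_fst.comp continuous_fst).prodMk
      (((continuous_snd.comp continuous_fst).clm_apply (hζc.comp continuous_snd)).prodMk
        ((continuous_snd.comp continuous_fst).clm_apply continuous_const))
  set Pset : Set (((E4 →L[ℝ] E4) × (E4 →L[ℝ] E4)) × (ℝ × ℝ)) := C ×ˢ (Icc (-S) S ×ˢ Icc (-T) T) with hPset
  have hPsetc : IsCompact Pset := (isCompact_inversePairs Γ).prod (isCompact_Icc.prod isCompact_Icc)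
  set K : Set ((E4 →L[ℝ] E4) × E4 × E4) := Θ '' Pset with hK
  have hKc : IsCompact K := hPsetc.image hΘc
  -- exact values on `K`
  have hexact : ∀ π ∈ Pset, Kerr.radius a ((Θ π).1 (Θ π).2.1) = ρ + π.2.1 / 2 ∧
      Kerr.bilin M a ((Θ π).1 (Θ π).2.1) ((Θ π).1 (Θ π).2.2) ((Θ π).1 (Θ π).2.2) =
        -(3 / 4) + M * (ρ + π.2.1 / 2) / (2 * ((ρ + π.2.1 / 2) ^ 2 + a ^ 2)) := by
    rintro ⟨⟨P, Q⟩, ⟨s, τ⟩⟩ ⟨⟨hPQ, -, -, -⟩, ⟨hs, -⟩⟩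
    have hPQv : ∀ v : E4, P (Q v) = v := fun v ↦ by
      have := congrArg (fun f : E4 →L[ℝ] E4 ↦ f v) hPQ
      simpa using this
    simp only [hΘ, hPQv]
    have hpos : 0 < ρ + s / 2 := by have := hs.1; linarith
    exact kerr_bilin_escapeConfig M a ρ s τ hpos
  set Ω : Set ((E4 →L[ℝ] E4) × E4 × E4) := {p | 0 < Kerr.radius a (p.1 p.2.1)} with hΩ
  have hΩo : IsOpen Ω := isOpen_lt continuous_const (continuous_config_radius a)
  have hKΩ : K ⊆ Ω := by
    rintro p ⟨π, hπ, rfl⟩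
    show 0 < Kerr.radius a ((Θ π).1 (Θ π).2.1)
    rw [(hexact π hπ).1]
    have := hπ.2.1.1; linarith
  -- the two margins
  obtain ⟨δ₁, hδ₁, hm₁⟩ := exists_uniform_margin hKc hΩo hKΩ
    ((continuous_config_radius a).continuousOn (s := Ω)) hε
  obtain ⟨δ₂, hδ₂, hm₂⟩ := exists_uniform_margin hKc hΩo hKΩ (continuousOn_config_value M a) hε
  refine ⟨min δ₁ δ₂, lt_min hδ₁ hδ₂, fun P Q hPQ hQP hP hQ s hs τ hτ P' z' hP' hz' ↦ ?_⟩
  have hπ : ((P, Q), (s, τ)) ∈ Pset := ⟨⟨hPQ, hQP, hP, hQ⟩, ⟨hs, hτ⟩⟩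
  have hb : Θ ((P, Q), (s, τ)) ∈ K := mem_image_of_mem Θ hπ
  obtain ⟨hr, hv⟩ := hexact _ hπ
  have hΘb : Θ ((P, Q), (s, τ)) = (P, Q (ζ (s, τ)), Q w₀) := rfl
  have hdist : dist ((P', z', Q w₀) : (E4 →L[ℝ] E4) × E4 × E4) (Θ ((P, Q), (s, τ))) ≤ min δ₁ δ₂ := by
    rw [hΘb, Prod.dist_eq, Prod.dist_eq, dist_eq_norm, dist_eq_norm, dist_self]
    exact max_le hP' (max_le hz' (le_min hδ₁.le hδ₂.le))
  obtain ⟨-, h1⟩ := hm₁ _ hb (P', z', Q w₀) (hdist.trans (min_le_left _ _))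
  obtain ⟨-, h2⟩ := hm₂ _ hb (P', z', Q w₀) (hdist.trans (min_le_right _ _))
  simp only [hΘ] at hr hv h1 h2
  rw [hr] at h1
  rw [hv] at h2
  exact ⟨h1, by linarith [(abs_lt.mp h2).2]⟩

/-- Registered one-line form (stub `isCompact_inversePairs_rechart` of the crux item) of
`isCompact_inversePairs`. [folklore] -/
theorem isCompact_inversePairs_rechart : ∀ Γ : ℝ, IsCompact {q : (E4 →L[ℝ] E4) × (E4 →L[ℝ] E4) | q.1.comp q.2 = 1 ∧ q.2.comp q.1 = 1 ∧ ‖q.1‖ ≤ Γ ∧ ‖q.2‖ ≤ Γ} :=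
  isCompact_inversePairs

end Summit.FinalStateConjecture.FinalStateConjecture.Theorems
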